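/-
Copyright (c) 2026 the pub-hodgecm-mathlib formalisation cell (harness21).  Prover seat hodgecm-mathlib-LH4-p10 (g0), req620 Track A «(D-RAM) FOUR-FRAME» squad
(heir LEAD F0P3a-plan (g19) «FOUR-FRAME SKELETON LANDED» EMIT #7 `stub_U3_stableLaw_RP`; dealer LH4-plan (g10)).  2026-09-03.
-/
import Summits.HodgeConjecture.HodgeConjecture.Theorems.F0P3cDyRamFixedCountDiagonalModel   -- ★ p855032 (LH4-p11): `fixedVertexCount_frameElt_eq_ncard_diagonal_model`, `ncard_fixed_diagonal_smul_eq`, `ncard_fixed_diagonal_eq_of_exists_norm`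
import HarnessLib

/-!
# Crux `H413`, line LH4 «(D-RAM) FOUR-FRAME» road — unit U3_Laws (iii), TIER 2 SUPPORT: THE EIGHTFOLD SYMMETRISATION OF THE FOUR-FRAME SUM
# (step (2b) of the (S-fin) reduction of the STABLE LAW, both vertex types; serves `stub_U3_stableLaw_RP` and `stub_U3_stableLaw_RU` alike)

Cell `hodgecm-mathlib` (D-0151), FLOOR 0, crux item H413 = `stmt-HodgeConjecture-24833`, route of record `HCCMUnconditional`; squad F0∕P3c∕LH4 (req618∕req620).  THEOREMS ONLY
(no `def`, no instance, no notation, no `sorry`, default heartbeats); lane `--supports stmt-HodgeConjecture-24833 --as helper` (count-neutral).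

WHAT IS PROVED.  Let `(K, σ, ϖ)` carry the datum clauses (`σ` an isometric involution, `|ϖ| = exp(−1)`, non-zero `σ`-fixed elements of EVEN valuation), let `c` be a `σ`-fixed
UNIT for which the INDEX-TWO DICHOTOMY holds (every non-zero `σ`-fixed `x` is a norm `z·σz` or `c` times a norm — for a genuine local field, `c` any non-norm unit; if `c` is itself a
norm the dichotomy says every class is trivial and the identity below degenerates correctly), let `f` be a four-frame family (★ #0a H7), `T` the diagonal literal `diag(α, β, 1)` and
`Γ_b` the frame elements `frameElt σ f b α β` (H8).  For a sign vector `s : Fin 3 → Bool` write `h_s = diag(d_s)`, `d_s i = c` if `s i` and `1` otherwise (one unit diagonal form per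
class of `(F^×∕N E^×)³`), and `C_t(s) = #{M : M a type-t vertex lattice of (K³, h_s), T·M = M}`.  THEN, for every vertex type `t`:

  `2 · Σ_{b : Fin 4} fixedVertexCount σ ϖ t Γ_b = Σ_{s : Fin 3 → Bool} C_t(s)`          (`two_mul_sum_fixedVertexCount_eq_sum_signClasses`).

So the four-frame (stable) sum of the census — the left side of the STABLE LAW (S) of ★ №1 `StableLawAt` — is HALF the sum of the diagonal-model counts over ALL EIGHT sign classes
`H¹(F, T) ≅ (ℤ∕2)³` (both pure inner forms), a frame-free quantity.  This is step (2b) of the finite reformulation (S-fin) of (S) (LH4-p10 (g0) REPORTS 1–2, LH4-p11 (g0) DATUM §4,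
2026-09-03): step (1) «`n_t(γ_b)` = the model count of the frame's class» and step (2a) «a unit scalar of the form changes nothing» are ★ p855032; step (3) «orbit count under
`(E^×)³` down to the finite ring `𝒪_E∕𝔣`» is the remaining reduction, and the finite count itself is the law.

THE MATHEMATICS ([Rogawski1990, §3.6 pp. 28–29, §4.9 p. 55]; [Jacobowitz1962, §4]; [LanglandsShelstad1987, §1.3]).  (A) By ★ p855032 each `Γ_b` is counted in a unit diagonal
model `diag(d)` whose entries have the norm classes of the frame, `(ω(d₀), ω(d₁), ω(d₂)) = (ε₁, ε₂, ω(−1)ε₁ε₂)` with `(ε₁, ε₂) = signPair b` (H4∕H7); by the dichotomy every `d_i`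
is `z σz` or `c·z σz`, so ★ `ncard_fixed_diagonal_eq_of_exists_norm` moves the count to the representative form `h_{s(b)}`, `s(b) = (ε₁ = −1, ε₂ = −1, ω(−1)ε₁ε₂ = −1)`.
(B) The unit scalar `c` carries `h_s` to `diag(c·d_s)`, whose entries `c` ∕ `c² = cσc` represent the COMPLEMENTARY class `¬s`; so `C_t(s) = C_t(¬s)` (★ `ncard_fixed_diagonal_smul_eq`
+ (A)'s transport).  (C) `b ↦ s(b)` is a bijection of `Fin 4` onto the four sign vectors with `#{i : s i} ≡ [ω(−1) = −1] (mod 2)` and `b ↦ ¬s(b)` onto the other four (a `decide`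
over the two values of `ω(−1)`); hence `2 Σ_b n_t(Γ_b) = Σ_b C_t(s(b)) + Σ_b C_t(¬s(b)) = Σ_s C_t(s)`.
* §1 `normSign_eq_one_or`, `exists_norm_of_normSign_eq_one`, `exists_rep_of_dichotomy` (the class representative `1` ∕ `c` of a `σ`-fixed unit, as an `∃ z ≠ 0, σz·r·z = x`).
* §2 `ncard_fixed_signClass_eq_compl` ((B): `C_t(s) = C_t(¬s)`).
* §3 `sum_signClasses_eq_sum_add_sum` ((C): the eightfold bookkeeping), and the head `two_mul_sum_fixedVertexCount_eq_sum_signClasses`.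
HONEST LABEL.  Count-neutral (`--supports`); nothing printed is asserted; the census laws stay PROVER TARGETS; the verdict of record for (D-RAM) stays PRINT
[LanglandsShelstad1989 Thm. p. 484 ∕ Rogawski1990 Prop. 4.9.1 (a)] ∕ XL; `HC_CM` is proved only modulo the 7 printed citations (2 remaining named inputs: hLiu418 =
`stmt-HodgeConjecture-24832`, h413 = `stmt-HodgeConjecture-24833`) until rung 0 closes.

## References
* [Rogawski1990] J. D. Rogawski, *Automorphic Representations of Unitary Groups in Three Variables*, Ann. of Math. Stud. 123 (1990), §3.6 pp. 28–29 (elliptic tori, the classes in a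
  stable class), §4.9 Prop. 4.9.1 (a) p. 55 (orbital integrals as fixed-lattice counts).
* [LanglandsShelstad1987] R. P. Langlands, D. Shelstad, *On the definition of transfer factors*, Math. Ann. 278 (1987), §1.3 (`𝔇(T) = ker(H¹(F,T) → H¹(F,G))` and the classes in a stable class).
* [Jacobowitz1962] R. Jacobowitz, *Hermitian forms over local fields*, Amer. J. Math. 84 (1962), §4 (diagonal forms, norm classes of the coefficients).
* [Kottwitz1986BaseChangeUnits] R. E. Kottwitz, *Base change for unit elements of Hecke algebras*, Compositio Math. 60 (1986), §1 pp. 240–241 (fixed-lattice counting).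
-/

set_option autoImplicit false

noncomputable section

namespace Summit.HodgeConjecture.HodgeConjecture.Cruxes.H413.F0P3cDyRamStableSumSignClasses

open Matrix
open Literature.NumberTheory.Automorphic Literature.NumberTheory.Automorphic.HermitianLattice Literature.NumberTheory.Automorphic.UnitaryGroup
open Literature.NumberTheory.Automorphic.UnitaryLatticeTree Literature.NumberTheory.Automorphic.UnitaryThreeFourFrame
open Summit.HodgeConjecture.HodgeConjecture.Cruxes.H413.F0P3cDyRamFixedCountDiagonalModel
open scoped Valued WithZero Matrix MatrixGroups

/-! ## §1  Norm-class representatives under the index-two dichotomy -/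

section Reps

variable {K : Type} [Field K] (σ : K →+* K)

/-- `ω(x) ∈ {1, −1}` (★ #0a H1 `normSign` is an `if`). [cite: Rogawski1990, §4.9 p. 55] -/
theorem normSign_eq_one_or (x : K) : normSign σ x = 1 ∨ normSign σ x = -1 := by
  unfold normSign
  split_ifs
  · exact Or.inl rfl
  · exact Or.inr rfl

/-- `ω(x) = 1` means `x` is a norm `z·σz`. [cite: Rogawski1990, §4.9 p. 55] -/
theorem exists_norm_of_normSign_eq_one {x : K} (h : normSign σ x = 1) : ∃ z : K, z * σ z = x := by
  by_contra hx
  unfold normSign at h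
  rw [if_neg hx] at h
  norm_num at h

/-- `ω(x) = −1` means `x` is not a norm. [cite: Rogawski1990, §4.9 p. 55] -/
theorem not_exists_norm_of_normSign_eq_neg_one {x : K} (h : normSign σ x = -1) : ¬ ∃ z : K, z * σ z = x := by
  intro hx
  unfold normSign at h
  rw [if_pos hx] at h
  norm_num at h

/-- **THE CLASS REPRESENTATIVE.**  Under the index-two dichotomy for a `σ`-fixed `c` (every non-zero `σ`-fixed `x` is `z σz` or `c · z σz`), a non-zero `σ`-fixed `x` is congruent
to the representative `r = 1` (if `ω(x) = 1`) or `r = c` (if `ω(x) = −1`): `σz · r · z = x` for some `z ≠ 0`. [cite: Jacobowitz1962, §4] [cite: LanglandsShelstad1987, §1.3] -/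
theorem exists_rep_of_dichotomy {c : K} (hσc : σ c = c) (hc0 : c ≠ 0)
    (hdich : ∀ x : K, σ x = x → x ≠ 0 → (∃ z : K, z * σ z = x) ∨ ∃ z : K, z * σ z = c * x)
    {x : K} (hσx : σ x = x) (hx0 : x ≠ 0) :
    ∃ z : K, z ≠ 0 ∧ σ z * (if normSign σ x = -1 then c else 1) * z = x := by
  rcases normSign_eq_one_or σ x with h1 | h1
  · obtain ⟨z, hz⟩ := exists_norm_of_normSign_eq_one σ h1
    refine ⟨z, fun h0 => hx0 (by rw [← hz, h0, zero_mul]), ?_⟩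
    rw [h1, if_neg (by norm_num), mul_one, mul_comm, hz]
  · have hxn := not_exists_norm_of_normSign_eq_neg_one σ h1
    rcases hdich x hσx hx0 with hn | ⟨z, hz⟩
    · exact absurd hn hxn
    · refine ⟨z / c, div_ne_zero (fun h0 => hx0 ?_) hc0, ?_⟩
      · have : c * x = 0 := by rw [← hz, h0, zero_mul]
        exact (mul_eq_zero.1 this).resolve_left hc0
      · rw [h1, if_pos rfl, map_div₀, hσc]
        field_simp
        linear_combination hz

end Reps

/-! ## §2  The count of a sign class equals the count of the complementary class -/

section Compl

variable {K : Type} [Field K] [Valued K ℤᵐ⁰]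

/-- **(B) `C_t(s) = C_t(¬s)`.**  For a `σ`-fixed unit `c`, the unit diagonal forms `h_s = diag(d_s)` (`d_s i = c` if `s i`, else `1`) and `h_{¬s}` have the same number of
`T`-fixed type-`t` vertex lattices for every DIAGONAL `T`: the scalar `c` carries `h_{¬s}` to `diag(c · d_{¬s})` (★ `ncard_fixed_diagonal_smul_eq`), whose entries `c` (where `s i`)
and `c·c = c σc` (where `¬ s i`) are congruent to `d_s i` by `z = 1`, `z = c` (★ `ncard_fixed_diagonal_eq_of_exists_norm`). [cite: Jacobowitz1962, §4] [cite: Rogawski1990, §3.6 pp. 28–29] -/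
theorem ncard_fixed_signClass_eq_compl (σ : K →+* K) (ϖ : K) {c : K} (hσc : σ c = c) (hvc : Valued.v c = 1)
    (s : Fin 3 → Bool) (e : Fin 3 → K) (T : GL (Fin 3) K) (hT : (T : Matrix (Fin 3) (Fin 3) K) = Matrix.diagonal e) (t : ℕ) :
    {M : Submodule 𝒪[K] (Fin 3 → K) | IsVertexLattice σ ϖ (Matrix.diagonal fun i => if s i then c else (1 : K)) t M ∧ mapGL T M = M}.ncard =
      {M : Submodule 𝒪[K] (Fin 3 → K) | IsVertexLattice σ ϖ (Matrix.diagonal fun i => if (!s i) then c else (1 : K)) t M ∧ mapGL T M = M}.ncard := by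
  have hc0 : c ≠ 0 := fun h => by rw [h, map_zero] at hvc; exact zero_ne_one hvc
  -- `diag(c • d_{¬s})` has the same count as `diag(d_{¬s})` …
  rw [← ncard_fixed_diagonal_smul_eq σ ϖ hvc (fun i => if (!s i) then c else (1 : K)) T t]
  -- … and is entrywise congruent to `diag(d_s)`
  have h : ∀ i : Fin 3, ∃ z : K, z ≠ 0 ∧ σ z * (fun i => if s i then c else (1 : K)) i * z = (c • fun i => if (!s i) then c else (1 : K)) i := by
    intro i
    by_cases hs : s i
    · refine ⟨1, one_ne_zero, ?_⟩
      simp [hs, map_one]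
    · refine ⟨c, hc0, ?_⟩
      simp [hs, hσc]
  exact (ncard_fixed_diagonal_eq_of_exists_norm σ ϖ h e T hT t).symm

end Compl

/-! ## §3  The eightfold bookkeeping and the head -/

section Head

variable {K : Type} [Field K] [Valued K ℤᵐ⁰] {σ : K →+* K} {ϖ : K}

/-- **(C) EIGHTFOLD BOOKKEEPING.**  For `ω ∈ Bool` (`ω = true` iff `ω(−1) = −1`) let `s_ω(b) = (ε₁(b) = −1, ε₂(b) = −1, (ε₁ε₂)(b) = −1 XOR ω)` be the sign vector of the frame
`b` (H4 `signPair`: `b = 0,1,2,3 ↦ (+,+), (+,−), (−,+), (−,−)`).  Then `b ↦ s_ω(b)` together with `b ↦ ¬s_ω(b)` enumerates `Fin 3 → Bool` exactly once, so for any `C`: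
`Σ_s C(s) = Σ_b C(s_ω b) + Σ_b C(¬ s_ω b)`. [cite: LanglandsShelstad1987, §1.3] [cite: Rogawski1990, §3.6 pp. 28–29] -/
theorem sum_signClasses_eq_sum_add_sum {A : Type*} [AddCommMonoid A] (ω : Bool) (C : (Fin 3 → Bool) → A) :
    ∑ s : Fin 3 → Bool, C s =
      ∑ b : Fin 4, C ![(![false, false, true, true] : Fin 4 → Bool) b, (![false, true, false, true] : Fin 4 → Bool) b,
            xor ((![false, true, true, false] : Fin 4 → Bool) b) ω] +
        ∑ b : Fin 4, C (fun i => !(![(![false, false, true, true] : Fin 4 → Bool) b, (![false, true, false, true] : Fin 4 → Bool) b,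
            xor ((![false, true, true, false] : Fin 4 → Bool) b) ω] i)) := by
  let g : Fin 4 ⊕ Fin 4 → (Fin 3 → Bool) := fun x =>
    match x with
    | Sum.inl b => ![(![false, false, true, true] : Fin 4 → Bool) b, (![false, true, false, true] : Fin 4 → Bool) b,
        xor ((![false, true, true, false] : Fin 4 → Bool) b) ω]
    | Sum.inr b => fun i => !(![(![false, false, true, true] : Fin 4 → Bool) b, (![false, true, false, true] : Fin 4 → Bool) b,
        xor ((![false, true, true, false] : Fin 4 → Bool) b) ω] i)
  have hg : Function.Bijective g := by
    cases ω <;> decide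
  rw [← Fintype.sum_equiv (Equiv.ofBijective g hg) (fun x => C (g x)) C (fun _ => rfl), Fintype.sum_sum_type]

/-- **HEAD — THE EIGHTFOLD SYMMETRISATION OF THE FOUR-FRAME SUM (step (2b) of (S-fin)), BOTH VERTEX TYPES.**  Under the datum clauses, with `c` a `σ`-fixed unit satisfying the
index-two dichotomy, for a four-frame family `f`, the diagonal literal `T = diag(α, β, 1)` and the frame elements `Γ_b = frameElt σ f b α β`:
`2 · Σ_b fixedVertexCount σ ϖ t Γ_b = Σ_{s : Fin 3 → Bool} #{M : M a type-t vertex lattice of (K³, diag(d_s)), T·M = M}`, `d_s i = c` if `s i` else `1` — the stable four-frame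
sum is half the sum of the diagonal-model counts over all eight sign classes `(F^× ∕ N E^×)³`. [cite: Rogawski1990, §3.6 pp. 28–29; §4.9 Prop. 4.9.1 (a) p. 55]
[cite: LanglandsShelstad1987, §1.3] [cite: Jacobowitz1962, §4] [cite: Kottwitz1986BaseChangeUnits, §1 pp. 240–241] -/
theorem two_mul_sum_fixedVertexCount_eq_sum_signClasses (hσ : ∀ x, σ (σ x) = x) (hvσ : ∀ a, Valued.v (σ a) = Valued.v a)
    (hϖ : Valued.v ϖ = WithZero.exp (-1 : ℤ)) (heven : ∀ x : K, σ x = x → x ≠ 0 → ∃ n : ℤ, Valued.v x = WithZero.exp (2 * n))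
    {c : K} (hσc : σ c = c) (hvc : Valued.v c = 1)
    (hdich : ∀ x : K, σ x = x → x ≠ 0 → (∃ z : K, z * σ z = x) ∨ ∃ z : K, z * σ z = c * x)
    {f : Fin 4 → Fin 3 → (Fin 3 → K)} (hf : IsFourFrameFamily σ f) (α β : K)
    (T : GL (Fin 3) K) (hT : (T : Matrix (Fin 3) (Fin 3) K) = Matrix.diagonal ![α, β, 1])
    (Γ : Fin 4 → GL (Fin 3) K) (hΓ : ∀ b, (Γ b : Matrix (Fin 3) (Fin 3) K) = frameElt σ f b α β) (t : ℕ) :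
    2 * ∑ b : Fin 4, fixedVertexCount σ ϖ t (Γ b) =
      ∑ s : Fin 3 → Bool, {M : Submodule 𝒪[K] (Fin 3 → K) |
        IsVertexLattice σ ϖ (Matrix.diagonal fun i => if s i then c else (1 : K)) t M ∧ mapGL T M = M}.ncard := by
  classical
  have hc0 : c ≠ 0 := fun h => by rw [h, map_zero] at hvc; exact zero_ne_one hvc
  -- the sign table: `ω = true` iff `ω(−1) = −1`
  set ω : Bool := decide (normSign σ (-1 : K) = -1) with hω_def
  let e1 : Fin 4 → Bool := ![false, false, true, true]
  let e2 : Fin 4 → Bool := ![false, true, false, true]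
  let e12 : Fin 4 → Bool := ![false, true, true, false]
  let sb : Fin 4 → Fin 3 → Bool := fun b => ![e1 b, e2 b, xor (e12 b) ω]
  let C : (Fin 3 → Bool) → ℕ := fun s =>
    {M : Submodule 𝒪[K] (Fin 3 → K) | IsVertexLattice σ ϖ (Matrix.diagonal fun i => if s i then c else (1 : K)) t M ∧ mapGL T M = M}.ncard
  -- (A) each frame is counted by its sign class
  have hA : ∀ b : Fin 4, fixedVertexCount σ ϖ t (Γ b) = C (sb b) := by
    intro b
    obtain ⟨d, hd1, hσd, hcls, hcount⟩ := fixedVertexCount_frameElt_eq_ncard_diagonal_model hσ hvσ hϖ heven hf b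
    rw [hcount α β T (Γ b) hT (hΓ b) t]
    -- the classes of `d`: `(ε₁, ε₂, ω(−1) ε₁ ε₂)`
    obtain ⟨-, -, h0, h1, h2⟩ := hf b
    have hd0 : ∀ i, d i ≠ 0 := fun i h => by
      have := hd1 i; rw [h, map_zero] at this; exact zero_ne_one this
    -- `normSign σ (d i) = -1 ↔ sb b i`
    have hsign : ∀ i : Fin 3, (normSign σ (d i) = -1 ↔ sb b i = true) := by
      have hω : (normSign σ (-1 : K) = -1 ↔ ω = true) := by rw [hω_def]; simp
      have hωcases := normSign_eq_one_or σ (-1 : K)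
      intro i
      fin_cases i
      · change normSign σ (d 0) = -1 ↔ e1 b = true
        rw [hcls 0, h0]
        fin_cases b <;> simp [e1, signPair]
      · change normSign σ (d 1) = -1 ↔ e2 b = true
        rw [hcls 1, h1]
        fin_cases b <;> simp [e2, signPair]
      · change normSign σ (d 2) = -1 ↔ xor (e12 b) ω = true
        rw [hcls 2, h2]
        rcases hωcases with hp | hm
        · have hωf : ω = false := by
            rw [hω_def, decide_eq_false_iff_not, hp]; norm_num
          rw [hp, hωf]
          fin_cases b <;> simp [e12, signPair]
        · have hωt : ω = true := by rw [hω_def, decide_eq_true_eq, hm]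
          rw [hm, hωt]
          fin_cases b <;> simp [e12, signPair]
    -- transport `diag(d)` to the representative form `diag(d_{sb b})`
    refine ncard_fixed_diagonal_eq_of_exists_norm σ ϖ (d := fun i => if sb b i then c else (1 : K)) (d' := d) (fun i => ?_) _ T hT t
    obtain ⟨z, hz0, hz⟩ := exists_rep_of_dichotomy σ hσc hc0 hdich (hσd i) (hd0 i)
    refine ⟨z, hz0, ?_⟩
    by_cases hs : sb b i = true
    · rw [if_pos ((hsign i).2 hs)] at hz
      simpa [hs] using hz
    · have hns : ¬ normSign σ (d i) = -1 := fun h => hs ((hsign i).1 h)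
      rw [if_neg hns] at hz
      simpa [hs] using hz
  -- (B) each class has the count of its complement
  have hB : ∀ b : Fin 4, C (sb b) = C (fun i => !(sb b i)) := fun b =>
    ncard_fixed_signClass_eq_compl σ ϖ hσc hvc (sb b) _ T hT t
  -- (C) bookkeeping
  calc 2 * ∑ b : Fin 4, fixedVertexCount σ ϖ t (Γ b)
      = ∑ b : Fin 4, C (sb b) + ∑ b : Fin 4, C (fun i => !(sb b i)) := by
        rw [two_mul, Finset.sum_congr rfl fun b _ => hA b]
        exact congrArg _ (Finset.sum_congr rfl fun b _ => hB b)
    _ = ∑ s : Fin 3 → Bool, C s := (sum_signClasses_eq_sum_add_sum ω C).symm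

end Head

end Summit.HodgeConjecture.HodgeConjecture.Cruxes.H413.F0P3cDyRamStableSumSignClasses

end
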